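import Literature.MathematicalPhysics.QuantumFieldTheory.Balaban1983to89.NodeOLettersOfWalksAcross
import Literature.MathematicalPhysics.QuantumFieldTheory.Balaban1983to89.B13LocalKernelWalks

/-!
# `Balaban1983to89.NodeOLettersOfWalksPerturbative` — THE W-WALKS RUNG, REFERENCE EDITION: the two COMPLEX-BACKGROUND
# accretivities of `NodeOLettersOfWalksAcross.TermWalks` DERIVED from accretivity at the reference configuration by
# [Balaban1988RG2Cluster] p. 15's «perturbative argument» at kernel level, and its five volume sums DERIVED from torus geometry

statement-level bookkeeping over published theorems with citation tags; kernel-checked compositions of tree theorems; nothing here is a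
claim about the Yang–Mills mass gap.

Cell `pub-ymgap`, D-0062 Track A, node N10 = [Balaban1988RG2Cluster] Lemmas 1–3; seat `dag-n10-b` g6 (-b FIRST-MISSING-ESTIMATE).  WHY.
The per-term input of record of NODE O's binder — `NodeOLettersOfWalksAcross.TermWalks 𝒦 q` (p443891), composed to
`B13TermWalkDataOneTorus.ExistsUniformAcrossSmall` by `acrossSmall_of_walks(_std)` — has twelve clauses.  Five of them are in the currency
of [Balaban1985BackgroundPropagators] Thm 3.10 (three joint walk expansions, through `X`, analytic on the `R`-ball) and of the term's
geometry (`nonempty`, `far`); SEVEN are not: the two accretivities of the precisions `P` and `A2` AT EVERY COMPLEX `(σ,u)` of polydisc ×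
ball — print states no theorem of this shape; [II] p. 15: *"For the pair (U′, 0) the operators are symmetric, and the measure is positive,
and then the estimates are simpler. The general case is handled by a perturbative argument."* — and the five volume sums
`volN₀ volN volN' volΛN volΛ`, which are torus geometry.  THIS FILE derives all seven:
* the accretivities from (i) accretivity AT THE REFERENCE CONFIGURATION `(σ,u) = (0,0)` only (where print's operators are real
  symmetric and [Balaban1985BackgroundPropagators] Thm 3.12 ∕ (3.133)-shape positivity is the printed input), (ii) the joint walk
  expansion's OWN letters — the σ-part of (2.16) at the reference background from far-ness of the index locations from the σ-region
  (`JointWalkExpansion.sub_ref_sigma`: print p. 13 *"we assume that dist(X, Z₀) > ⅔M"*, (2.16)'s `O(1)e^{−⅓δ₀M}`) and the `u`-part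
  from analyticity + the uniform majorants by the Schwarz lemma (`B13PrimitiveKernels216.sub_ref_le_of_analytic`, (2.16)'s
  `O(α₀ + α₁)`) — and (iii) a Schur bound (row ∕ column sums of the (2.16)-shape difference against a volume sum): accretivity with HALF
  the reference constant on the polydisc × a smaller ball, under two explicit margins;
* the volume sums from two integers — a multiplicity bound `n_B` of the location maps and a dimension bound `d_m` of the torus — by the
  row sum (2.61) on every torus (`B13LocalKernelWalks.rowSum_torus_of_le`, constant `c₀(1,η)^{d_m}`).
NET EFFECT on NODE A's per-term input list for [II] Lemma 3: `TermWalksRef 𝒦 r` = {`X ≠ ∅`; the product reading with joint walk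
expansions of `L` and `P`; a joint walk expansion of `A2`; accretivity of `P(0,0)` and of `A2(0,0)` (two REAL-configuration constants);
far-ness of BOTH location maps from `X`; two multiplicity bounds; `ν ≤ d_m`} ⟹ `TermWalks 𝒦 (r.toWalkPackage R₁)` (§4), and across a
family `UniformWalksAcrossRef 𝓣 r ⟹ UniformWalksAcross 𝓣 (r.toWalkPackage R₁) ⟹ ExistsUniformAcrossSmall` (§5, BY NAME through
`acrossSmall_of_walks_std`).  Everything «at complex backgrounds» in the rung other than the three expansions themselves is thereby a
tree theorem.  LOCATED NOTE (print (1.11) p. 5, read for this file): the σ-carrying walk terms are NOT globally small — *"If m ≤ 24, then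
we can have short walks, in fact with |ω| = 0, and the expression can be bounded by e^{16κ₁} only"* — so the σ-part of the perturbation
is small ONLY through far-ness (the index locations of the (2.14)-term's kernels sit in `Z₀`, the parameters on the `LM`-cubes of `σ₀`
outside `Z′₀`, p. 13); this is why the reference edition asks far-ness of the column locations `locN` too (`farN`), not a global σ-letter.
* §1 `volume_of_multiplicity` — `Σ_k e^{−ηd₁(a, loc k)} ≤ n_B·c₀(1,η)^{d_m}` (fibre count × the row sum on every torus).
* §2 `accretive_of_accretive_add` (the perturbative step with a COMPLEX reference: `m₀`-accretive `A` + perturbation with absolute row ∕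
  column sums `≤ p` is `(m₀ − p)`-accretive, by the Schur bound on the form; twin of `B13Sqrt27Accretive.accretive_of_coercive_add`,
  whose reference is real).
* §3 `accretive_of_reference` (a kernel family on polydisc × ball: reference accretivity + (2.16)-shape σ-letter + analyticity +
  majorants + volume sum ⟹ accretivity on the `α`-ball, constant `m₀ − (θ + 2K̄α/R)c_V`), `accretive_of_jointWalkExpansion_far` (the
  same with the σ-letter DISCHARGED from a joint walk expansion through `X` and far-ness: `θ = 2K̄e^{−εR_σ}`).  TWIN of the latter, landed
  the same hour by the cell's [B13] typer: `B13JointWalkExpansionAlgebra.accretive_of_jointWalkExpansion` (reference REAL coercive, volume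
  sums at the expansion's rate); the edition here takes any accretive COMPLEX reference and any rate `≤ κ_P` — the currency of §4.
* §4 `RefPackage` (+ `Admissible`, `toWalkPackage`), `TermWalksRef`, `termWalks_of_ref`.
* §5 `UniformWalksAcrossRef`, `uniformWalksAcross_of_ref`, `RefPackage.admissible_toWalkPackage`, `acrossSmall_of_ref_std`.
* §6 `margin_of_thresholds`, `termWalks_of_ref_thresholds`, `acrossSmall_of_ref_thresholds` — the two margins as four division-free
  thresholds (`8K̄c·e^{−εR_σ} ≤ m`, `8K̄c·R₁ ≤ mR`): ORDER OF CHOICES `(K̄, m₀, c_V, ε)` ⟹ `R_σ` large, `R₁` small, no circularity.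
NON-VACUITY: not re-done here — `TermWalksRef` differs from the inhabited `TermWalks` (models `NodeOLettersOfWalksWitness(Sym)`,
`NodeOLettersOfWalksAcrossWitness`) only by asking LESS accretivity (at `(0,0)` instead of everywhere) and MORE geometry (`farN`,
multiplicities, `ν ≤ d_m`); a σ- and `u`-independent one-site mass term far from a one-point σ-region inhabits it with every `R_σ` on a
large enough torus (degenerate; not typed).

CITATIONS.  [Balaban1988RG2Cluster] (1.11) p. 5; p. 13 (σ₀ = the `LM`-cubes disjoint from the interior of `Z′₀`; *"dist(X, Z₀) > ⅔M"*;
the square root (2.7)); p. 15 (the analyticity space with `α′₀, α′₁`; the perturbative argument); (2.14)–(2.16) pp. 15–16;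
[Balaban1985BackgroundPropagators] Thm 3.10 ∕ (3.108) p. 416, Thm 3.12 p. 423, (3.154) p. 427; [Balaban1984PropagatorsII] Lemma 2.1 (2.61) p. 234.

HONEST FRAMING: finite-matrix bookkeeping + a [folklore] perturbation lemma + torus row sums, joining tree interfaces by name; NOTHING of
Bałaban's operators is constructed; whether HIS `C*Δ_k(σ)C_{Z₀ᶜ}`, `Δ^{(k)}(Z₀,σ)` and the full precision carry the three expansions with ONE
package at complex backgrounds, and are positive at the reference configuration with ONE constant across the family, is the OBJECT-level
content of [13] Thms 3.10 ∕ 3.12 ∕ cell GAPS G-B9-10 ∕ in-edge N06 and of the NODE 00 pin — the HYPOTHESES here, not outputs; count-neutral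
Track-A side landing; NOT a discharge of N10; NOT NODE O for Bałaban's family; NOT [B12] Thm 2; nothing continuum ∕ ℝ⁴ ∕ OS ∕ mass-gap ∕
Clay.  0 `sorry`; `structure`∕`def` = constant packages (bookkeeping data), no instance, no notation; standard axioms.
-/

noncomputable section

namespace Literature.MathematicalPhysics.QuantumFieldTheory.Balaban1983to89.NodeOLettersOfWalksPerturbative

open Metric Set Finset
open scoped Matrix
open Literature.MathematicalPhysics.QuantumFieldTheory.Balaban1983to89
open Literature.MathematicalPhysics.QuantumFieldTheory.Balaban1983to89.B9Thm34Ext (toB6)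
open Literature.MathematicalPhysics.QuantumFieldTheory.Balaban1983to89.B9Thm37GlueTorus
  (torusGeom tdist1 tdist1_nonneg tdist1_self tdist1_comm)
open Literature.MathematicalPhysics.QuantumFieldTheory.Balaban1983to89.TreeLengthTorus (TPt)
open Literature.MathematicalPhysics.QuantumFieldTheory.Balaban1983to89.B5TorusCover (UT)
open Literature.MathematicalPhysics.QuantumFieldTheory.Balaban1983to89.B11SectG (RowSum)
open Literature.MathematicalPhysics.QuantumFieldTheory.Balaban1983to89.B13JointWalkExpansion (JointWalkExpansion)
open Literature.MathematicalPhysics.QuantumFieldTheory.Balaban1983to89.B13PrimitiveKernels216 (sub_ref_le_of_analytic)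
open Literature.MathematicalPhysics.QuantumFieldTheory.Balaban1983to89.B13LocalKernelWalks (rowSum_torus_of_le)
open Literature.MathematicalPhysics.QuantumFieldTheory.Balaban1983to89.B13TermWalkData (TermKernels TorusTerms)
open Literature.MathematicalPhysics.QuantumFieldTheory.Balaban1983to89.B13TermWalkDataOneTorus (ExistsUniformAcrossSmall)
open Literature.MathematicalPhysics.QuantumFieldTheory.Balaban1983to89.NodeOLettersOfWalksAcross
  (WalkPackage TermWalks UniformWalksAcross acrossSmall_of_walks_std)
open Literature.MathematicalPhysics.QuantumFieldTheory.Balaban1983to89.B13Sqrt27Accretive (invSqrt)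

variable {d N' : ℕ} {ν : ℕ} {Nf : Fin ν → ℕ} [∀ i, NeZero (Nf i)]
variable {E : Type*} [NormedAddCommGroup E] [NormedSpace ℂ E]

/-! ## §1. The volume sums are torus geometry: multiplicity of the location map × the row sum (2.61) -/

omit [∀ i, NeZero (Nf i)] in
/-- A sum over an index set located on the torus is at most the multiplicity of the location map times the sum over the torus
(non-negative summand). [folklore] -/
private theorem sum_comp_le_mul_of_fibre {ι : Type} [Fintype ι] (loc : ι → UT Nf) {nB : ℕ}
    (hfib : ∀ x : UT Nf, (Finset.univ.filter fun k => loc k = x).card ≤ nB)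
    {f : UT Nf → ℝ} (hf : ∀ x, 0 ≤ f x) :
    ∑ k, f (loc k) ≤ nB * ∑ x, f x := by
  classical
  rw [← Finset.sum_fiberwise Finset.univ loc (fun k => f (loc k)), Finset.mul_sum]
  refine Finset.sum_le_sum fun x _ => ?_
  have hinner : ∑ k ∈ Finset.univ.filter (fun k => loc k = x), f (loc k)
      = ((Finset.univ.filter fun k => loc k = x).card : ℝ) * f x := by
    rw [Finset.sum_congr rfl fun k hk => by rw [(Finset.mem_filter.1 hk).2], Finset.sum_const, nsmul_eq_mul]
  rw [hinner]
  exact mul_le_mul_of_nonneg_right (by exact_mod_cast hfib x) (hf x)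

/-- **THE VOLUME SUMS OF THE RUNG FROM TWO INTEGERS**: for a location map of multiplicity `≤ n_B` on a torus of dimension `ν ≤ d_m`
and a rate `η > 0`, `Σ_k e^{−ηd₁(a, loc k)} ≤ n_B·c₀(1,η)^{d_m}` for every torus point `a` — the row sum (2.61) on every torus
(`B13LocalKernelWalks.rowSum_torus_of_le`) times the multiplicity; ONE constant for an exhausting family of tori.
[cite: Balaban1984PropagatorsII, Lemma 2.1 (2.61) p.234; Balaban1985BackgroundPropagators, (3.154) p.427] -/
theorem volume_of_multiplicity {ι : Type} [Fintype ι] (loc : ι → UT Nf) {nB : ℕ}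
    (hfib : ∀ x : UT Nf, (Finset.univ.filter fun k => loc k = x).card ≤ nB)
    {η : ℝ} (hη : 0 < η) {dm : ℕ} (hν : ν ≤ dm) (a : UT Nf) :
    ∑ k, Real.exp (-(η * tdist1 Nf a (loc k))) ≤ nB * B6.c0 1 η ^ dm := by
  have h1 := sum_comp_le_mul_of_fibre loc hfib (f := fun x => Real.exp (-(η * tdist1 Nf a x)))
    (fun x => (Real.exp_pos _).le)
  have h2 : ∑ x : UT Nf, Real.exp (-(η * tdist1 Nf a x)) ≤ B6.c0 1 η ^ dm := rowSum_torus_of_le Nf hη hν a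
  exact h1.trans (mul_le_mul_of_nonneg_left h2 (Nat.cast_nonneg _))

/-! ## §2. The perturbative step with a complex reference (Schur bound on the form of the perturbation) -/

/-- **Schur bound for a form**: absolute row and column sums of `D` `≤ p` give `|Re Σ conj(v_i)(Dv)_i| ≤ p·Σ|v_i|²`
(private copy of the helper of `B13Sqrt27Accretive` ∕ `B13Sqrt27AccretiveSquare`). [folklore] -/
private theorem abs_re_form_le_of_absRowCol {n : Type*} [Fintype n] (D : Matrix n n ℂ) {p : ℝ} (hp : 0 ≤ p)
    (hrow : ∀ i, ∑ j, ‖D i j‖ ≤ p) (hcol : ∀ j, ∑ i, ‖D i j‖ ≤ p) (v : n → ℂ) :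
    |(∑ i, star (v i) * (D *ᵥ v) i).re| ≤ p * ∑ i, ‖v i‖ ^ 2 := by
  set S : ℝ := ∑ i, ‖v i‖ ^ 2 with hS
  have hS0 : 0 ≤ S := Finset.sum_nonneg fun i _ => by positivity
  have h1 : |(∑ i, star (v i) * (D *ᵥ v) i).re| ≤ ‖star v ⬝ᵥ (D *ᵥ v)‖ :=
    (Complex.abs_re_le_norm _).trans_eq rfl
  have h2 := Literature.Analysis.Matrix.norm_star_dotProduct_le_sqrt_mul_sqrt v (D *ᵥ v)
  have h3 := Literature.Analysis.Matrix.sum_norm_sq_mulVec_le_of_rowSum_le_of_colSum_le D hp hrow hcol v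
  have h4 : Real.sqrt (∑ i, ‖(D *ᵥ v) i‖ ^ 2) ≤ p * Real.sqrt S := by
    rw [← Real.sqrt_sq hp, ← Real.sqrt_mul (sq_nonneg p)]
    exact Real.sqrt_le_sqrt (by nlinarith [h3])
  calc |(∑ i, star (v i) * (D *ᵥ v) i).re| ≤ Real.sqrt S * Real.sqrt (∑ i, ‖(D *ᵥ v) i‖ ^ 2) := h1.trans h2
    _ ≤ Real.sqrt S * (p * Real.sqrt S) := mul_le_mul_of_nonneg_left h4 (Real.sqrt_nonneg _)
    _ = p * S := by rw [mul_left_comm, Real.mul_self_sqrt hS0]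

/-- **THE PERTURBATIVE STEP** (print p. 15: *"The general case is handled by a perturbative argument"*), complex reference: if `A`
is `m₀`-accretive (`m₀Σ|v_i|² ≤ Re⟨v, Av⟩`) and the perturbation `D` has absolute row and column sums `≤ p`, then `A + D` is
`(m₀ − p)`-accretive.  Twin of `B13Sqrt27Accretive.accretive_of_coercive_add` (real coercive reference); here the reference is any
accretive complex matrix, e.g. a precision at the reference configuration. [cite: Balaban1988RG2Cluster, p.15, (2.16) p.16] -/
theorem accretive_of_accretive_add {n : Type*} [Fintype n] (A D : Matrix n n ℂ) {m₀ p : ℝ} (hp : 0 ≤ p)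
    (hacc : ∀ v : n → ℂ, m₀ * ∑ i, ‖v i‖ ^ 2 ≤ (∑ i, star (v i) * (A *ᵥ v) i).re)
    (hrow : ∀ i, ∑ j, ‖D i j‖ ≤ p) (hcol : ∀ j, ∑ i, ‖D i j‖ ≤ p) (v : n → ℂ) :
    (m₀ - p) * ∑ i, ‖v i‖ ^ 2 ≤ (∑ i, star (v i) * ((A + D) *ᵥ v) i).re := by
  have hsplit : (∑ i, star (v i) * ((A + D) *ᵥ v) i)
      = (∑ i, star (v i) * (A *ᵥ v) i) + ∑ i, star (v i) * (D *ᵥ v) i := by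
    simp only [Matrix.add_mulVec, Pi.add_apply, mul_add, Finset.sum_add_distrib]
  rw [hsplit, Complex.add_re]
  have h1 := hacc v
  have h2 := neg_le_of_abs_le (abs_re_form_le_of_absRowCol D hp hrow hcol v)
  have h3 : (m₀ - p) * ∑ i, ‖v i‖ ^ 2 = m₀ * ∑ i, ‖v i‖ ^ 2 - p * ∑ i, ‖v i‖ ^ 2 := by ring
  linarith

/-! ## §3. Accretivity on polydisc × ball from accretivity at the reference configuration -/

section Reference

variable {c : B13.Consts} {n : Type} [Fintype n]

/-- **ACCRETIVITY AT COMPLEX BACKGROUND FROM THE REFERENCE CONFIGURATION, KERNEL LEVEL** — [II] p. 15's perturbative argument for a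
kernel family `P(σ,u)` (square, located by `loc`): IF `P(0,0)` is `m₀`-accretive (the pair `(U′,0)`: real symmetric operators,
[B9] Thm 3.12-shape positivity), the σ-part at the reference background obeys the (2.16) shape `‖(P(σ,0) − P(0,0))_{ik}‖ ≤ θ·e^{−κd₁}`
(print's `O(1)e^{−⅓δ₀M}`), the family is entrywise analytic in `u` on the `R`-ball with the uniform majorant `K̄e^{−κd₁}` (p. 15, the space
with `α′₀, α′₁`), and the volume sum at rate `κ` is `≤ c_V`, THEN for every σ of the polydisc and every `‖u‖ ≤ α < R` the kernel
`P(σ,u)` is `(m₀ − (θ + 2K̄α/R)·c_V)`-accretive: the difference `P(σ,u) − P(0,0)` obeys (2.16) with constant `θ + 2K̄α/R`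
(`B13PrimitiveKernels216.sub_ref_le_of_analytic`, Schwarz lemma), hence has absolute row ∕ column sums `≤ (θ + 2K̄α/R)c_V`, and §2 applies.
[cite: Balaban1988RG2Cluster, p.15, (2.16) p.16; Balaban1985BackgroundPropagators, Thm 3.12 p.423] -/
theorem accretive_of_reference (loc : n → UT Nf) (P : (TPt d N' → ℂ) → E → Matrix n n ℂ)
    {R α m₀ θ Kbar κ cV : ℝ} (hR : 0 < R) (hαR : α < R) (hα : 0 ≤ α) (hKbar : 0 ≤ Kbar) (hθ : 0 ≤ θ) (hcV : 0 ≤ cV)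
    (hacc : ∀ v : n → ℂ, m₀ * ∑ i, ‖v i‖ ^ 2 ≤ (∑ i, star (v i) * (P 0 0 *ᵥ v) i).re)
    (hσ : ∀ σ : TPt d N' → ℂ, (∀ j, ‖σ j‖ ≤ Real.exp c.κ₁) →
      ∀ i k, ‖(P σ 0 - P 0 0) i k‖ ≤ θ * Real.exp (-(κ * tdist1 Nf (loc i) (loc k))))
    (ha : ∀ σ : TPt d N' → ℂ, (∀ j, ‖σ j‖ ≤ Real.exp c.κ₁) →
      ∀ i k, DifferentiableOn ℂ (fun u => P σ u i k) (ball (0 : E) R))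
    (hm : ∀ σ : TPt d N' → ℂ, (∀ j, ‖σ j‖ ≤ Real.exp c.κ₁) → ∀ u ∈ ball (0 : E) R,
      ∀ i k, ‖P σ u i k‖ ≤ Kbar * Real.exp (-(κ * tdist1 Nf (loc i) (loc k))))
    (hvol : ∀ i, ∑ k, Real.exp (-(κ * tdist1 Nf (loc i) (loc k))) ≤ cV)
    (σ : TPt d N' → ℂ) (hσκ : ∀ j, ‖σ j‖ ≤ Real.exp c.κ₁) {u : E} (hu : ‖u‖ ≤ α) (v : n → ℂ) :
    (m₀ - (θ + 2 * Kbar * α / R) * cV) * ∑ i, ‖v i‖ ^ 2 ≤ (∑ i, star (v i) * (P σ u *ᵥ v) i).re := by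
  -- the (2.16)-shape bound of the difference `P(σ,u) − P(0,0)` (σ-part + Schwarz lemma)
  have hdiff : ∀ i k, ‖(P σ u - P 0 0) i k‖ ≤ (θ + 2 * Kbar * α / R) * Real.exp (-(κ * tdist1 Nf (loc i) (loc k))) :=
    fun i k => sub_ref_le_of_analytic (K := P σ) (Kref := P 0 0) hR hKbar hαR
      (g := fun i k => Real.exp (-(κ * tdist1 Nf (loc i) (loc k)))) (fun _ _ => (Real.exp_pos _).le)
      (hσ σ hσκ) (ha σ hσκ) (hm σ hσκ) hu i k
  have hcoef : 0 ≤ θ + 2 * Kbar * α / R := by positivity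
  -- absolute row and column sums of the difference
  have hrow : ∀ i, ∑ k, ‖(P σ u - P 0 0) i k‖ ≤ (θ + 2 * Kbar * α / R) * cV := fun i =>
    calc ∑ k, ‖(P σ u - P 0 0) i k‖ ≤ ∑ k, (θ + 2 * Kbar * α / R) * Real.exp (-(κ * tdist1 Nf (loc i) (loc k))) :=
          Finset.sum_le_sum fun k _ => hdiff i k
      _ = (θ + 2 * Kbar * α / R) * ∑ k, Real.exp (-(κ * tdist1 Nf (loc i) (loc k))) := by rw [Finset.mul_sum]
      _ ≤ (θ + 2 * Kbar * α / R) * cV := mul_le_mul_of_nonneg_left (hvol i) hcoef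
  have hcol : ∀ k, ∑ i, ‖(P σ u - P 0 0) i k‖ ≤ (θ + 2 * Kbar * α / R) * cV := fun k =>
    calc ∑ i, ‖(P σ u - P 0 0) i k‖ ≤ ∑ i, (θ + 2 * Kbar * α / R) * Real.exp (-(κ * tdist1 Nf (loc i) (loc k))) :=
          Finset.sum_le_sum fun i _ => hdiff i k
      _ = (θ + 2 * Kbar * α / R) * ∑ i, Real.exp (-(κ * tdist1 Nf (loc k) (loc i))) := by
          rw [Finset.mul_sum]; exact Finset.sum_congr rfl fun i _ => by rw [tdist1_comm]
      _ ≤ (θ + 2 * Kbar * α / R) * cV := mul_le_mul_of_nonneg_left (hvol k) hcoef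
  have h := accretive_of_accretive_add (P 0 0) (P σ u - P 0 0) (mul_nonneg hcoef hcV) hacc hrow hcol v
  rwa [add_sub_cancel] at h

/-- **THE SAME WITH THE σ-LETTER DISCHARGED FROM A JOINT WALK EXPANSION AND FAR-NESS** (the (2.16) mechanism of print p. 13 ∕ p. 16 in
full): a joint walk expansion of `P` through `X` on the `R`-ball (drop `ε ≥ 0`, torus rate `κ_P`, constant `K̄`), whose index locations are
`R_σ`-far from `X`, gives the σ-letter with `θ = 2K̄e^{−εR_σ}` (`JointWalkExpansion.sub_ref_sigma`), analyticity
(`JointWalkExpansion.analyticOnBall`) and the majorants (`JointWalkExpansion.majorants`) — at any rate `κ ≤ κ_P` at which a volume sum `c_V`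
is available; so `m₀`-accretivity of `P(0,0)` yields `(m₀ − (2K̄e^{−εR_σ} + 2K̄α/R)c_V)`-accretivity of `P(σ,u)` on polydisc × `α`-ball.
TWIN (landed the same hour by the cell's [B13] typer): `B13JointWalkExpansionAlgebra.accretive_of_jointWalkExpansion` — reference
`P(0,0) = T₀.map ofReal` with `T₀` REAL `γ`-coercive (through `B13Sqrt27Accretive.accretive_of_coercive_add`), volume sums of rows and of
columns at the expansion's torus rate.  Here: ANY accretive complex reference (what `TermWalksRef` records; a real coercive `T₀` gives it),
any rate `κ ≤ κ_P` carrying a volume sum (the rung's `c_V₀` sits at `κ_P/2`, its `c_V` at `η`), columns by the symmetry of `d₁`.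
[cite: Balaban1988RG2Cluster, p.13, p.15, (2.16) p.16; Balaban1985BackgroundPropagators, Thm 3.10 p.416, Thm 3.12 p.423] -/
theorem accretive_of_jointWalkExpansion_far {loc : n → UT Nf} {P : (TPt d N' → ℂ) → E → Matrix n n ℂ} {X : Finset (UT Nf)}
    {R ε kapP Kbar : ℝ} {W : Type} {T : W → (TPt d N' → ℂ) → E → Matrix n n ℂ} {SX : Set W} {A : W → ℝ}
    {D : W → UT Nf → UT Nf → ℝ} {ρw : ℝ}
    (h : JointWalkExpansion c loc loc P X R ε kapP Kbar T SX A D ρw) (hR : 0 < R) (hε : 0 ≤ ε) (hKbar : 0 ≤ Kbar)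
    {κ : ℝ} (hκP : κ ≤ kapP)
    {Rσ : ℝ} (hfar : ∀ i : n, ∀ z ∈ X, Rσ ≤ tdist1 Nf (loc i) z)
    {m₀ : ℝ} (hacc : ∀ v : n → ℂ, m₀ * ∑ i, ‖v i‖ ^ 2 ≤ (∑ i, star (v i) * (P 0 0 *ᵥ v) i).re)
    {cV : ℝ} (hcV : 0 ≤ cV) (hvol : ∀ i, ∑ k, Real.exp (-(κ * tdist1 Nf (loc i) (loc k))) ≤ cV)
    {α : ℝ} (hα : 0 ≤ α) (hαR : α < R)
    (σ : TPt d N' → ℂ) (hσκ : ∀ j, ‖σ j‖ ≤ Real.exp c.κ₁) {u : E} (hu : ‖u‖ ≤ α) (v : n → ℂ) :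
    (m₀ - (2 * Kbar * Real.exp (-(ε * Rσ)) + 2 * Kbar * α / R) * cV) * ∑ i, ‖v i‖ ^ 2
      ≤ (∑ i, star (v i) * (P σ u *ᵥ v) i).re := by
  -- rate bookkeeping: a majorant at the torus rate `κ_P` is one at any `κ ≤ κ_P`
  have hrate : ∀ i k, Real.exp (-(kapP * tdist1 Nf (loc i) (loc k))) ≤ Real.exp (-(κ * tdist1 Nf (loc i) (loc k))) :=
    fun i k => Real.exp_le_exp.2 (neg_le_neg (mul_le_mul_of_nonneg_right hκP (tdist1_nonneg _ _)))
  refine accretive_of_reference loc P hR hαR hα hKbar (by positivity) hcV hacc (fun σ' hσ' i k => ?_)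
    (fun σ' hσ' i k => h.analyticOnBall hε σ' hσ' i k) (fun σ' hσ' u' hu' i k => ?_) hvol σ hσκ hu v
  · exact (h.sub_ref_sigma hR hε hfar σ' hσ' i k).trans (mul_le_mul_of_nonneg_left (hrate i k) (by positivity))
  · exact (h.majorants hε σ' hσ' u' hu' i k).trans (mul_le_mul_of_nonneg_left (hrate i k) hKbar)

end Reference

/-! ## §4. The rung from reference data: `TermWalksRef ⟹ TermWalks` -/

/-- **THE REFERENCE PACKAGE** (fourteen reals, two naturals; ONE for every member and term of the family): analyticity radius `R`;
drop ∕ torus rate ∕ summability constant `(ε_L, κ_L, K̄_L)` of the local factor's expansion, `(ε_P, κ_P, K̄_P)` of the full precision's,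
`(ε_A, κ_A, K̄_A)` of the term precision's; the REFERENCE accretivity constants `m₀` (of `P(0,0)`) and `m_{A,0}` (of `A2(0,0)`) — print's
positivity at the pair `(U′, 0)`; the volume rate `η`; the far-ness `R_σ`; the multiplicity bound `n_B` of the location maps and the
dimension bound `d_m` of the tori.  Nothing asserted. [cite: Balaban1988RG2Cluster, p.13, p.15, (2.16) p.16; Balaban1985BackgroundPropagators, Thm 3.10 p.416, Thm 3.12 p.423] -/
structure RefPackage where
  R : ℝ
  εL : ℝ
  kapL : ℝ
  KbarL : ℝ
  εP : ℝ
  kapP : ℝ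
  KbarP : ℝ
  m₀ : ℝ
  εA : ℝ
  kapA : ℝ
  KbarA : ℝ
  mA₀ : ℝ
  η : ℝ
  Rσ : ℝ
  nB : ℕ
  dm : ℕ

namespace RefPackage

/-- Sign conditions on the reference package (`η > 0` and `η ≤ κ_A`: the volume rate is a decay rate of the term precision).
[cite: Balaban1988RG2Cluster, p.15, (2.16) p.16] -/
structure Admissible (r : RefPackage) : Prop where
  hR : 0 < r.R
  hεL : 0 ≤ r.εL
  hkapL : 0 ≤ r.kapL
  hKbarL : 0 ≤ r.KbarL
  hεP : 0 ≤ r.εP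
  hkapP : 0 < r.kapP
  hKbarP : 0 ≤ r.KbarP
  hm₀ : 0 < r.m₀
  hεA : 0 ≤ r.εA
  hkapA : 0 < r.kapA
  hKbarA : 0 ≤ r.KbarA
  hmA₀ : 0 < r.mA₀
  hη : 0 < r.η
  hηA : r.η ≤ r.kapA

/-- The volume constant at the rate `η`: `c_V = n_B·c₀(1,η)^{d_m}` (§1). [cite: Balaban1984PropagatorsII, Lemma 2.1 (2.61) p.234] -/
def cV (r : RefPackage) : ℝ := r.nB * B6.c0 1 r.η ^ r.dm

/-- The square root's Combes–Thomas volume constant at the rate `κ_P/2`: `c_V₀ = n_B·c₀(1,κ_P/2)^{d_m}` (§1).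
[cite: Balaban1984PropagatorsII, Lemma 2.1 (2.61) p.234; Balaban1988RG2Cluster, (2.7) p.13] -/
def cV₀ (r : RefPackage) : ℝ := r.nB * B6.c0 1 (r.kapP / 2) ^ r.dm

/-- **THE W-WALKS PACKAGE OF A REFERENCE PACKAGE on the accretivity radius `R₁`**: the same expansion constants on the smaller ball
`R₁`, HALF the reference accretivity constants, the geometric volume constants. [cite: Balaban1988RG2Cluster, p.15, (2.16) p.16] -/
def toWalkPackage (r : RefPackage) (R₁ : ℝ) : WalkPackage where
  R := R₁
  εL := r.εL
  kapL := r.kapL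
  KbarL := r.KbarL
  εP := r.εP
  kapP := r.kapP
  KbarP := r.KbarP
  m := r.m₀ / 2
  εA := r.εA
  kapA := r.kapA
  KbarA := r.KbarA
  mA := r.mA₀ / 2
  η := r.η
  cV := r.cV
  cV₀ := r.cV₀
  Rσ := r.Rσ

/-- `c₀(1,μ) ≥ 0` for `μ > 0` (indeed `≥ 1`, `B6Lemma21Arith.one_le_c0`). [cite: Balaban1984PropagatorsII, Lemma 2.1 (2.61) p.234] -/
theorem c0_nonneg {μ : ℝ} (hμ : 0 < μ) : 0 ≤ B6.c0 1 μ :=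
  zero_le_one.trans (B6Lemma21Arith.one_le_c0 (by simpa using hμ))

/-- `c_V ≥ 0`. [cite: Balaban1984PropagatorsII, Lemma 2.1 (2.61) p.234] -/
theorem cV_nonneg {r : RefPackage} (hr : r.Admissible) : 0 ≤ r.cV := by
  unfold cV; exact mul_nonneg (Nat.cast_nonneg _) (pow_nonneg (c0_nonneg hr.hη) _)

/-- `c_V₀ ≥ 0`. [cite: Balaban1984PropagatorsII, Lemma 2.1 (2.61) p.234] -/
theorem cV₀_nonneg {r : RefPackage} (hr : r.Admissible) : 0 ≤ r.cV₀ := by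
  unfold cV₀; exact mul_nonneg (Nat.cast_nonneg _) (pow_nonneg (c0_nonneg (by linarith [hr.hkapP])) _)

/-- The W-walks package of an admissible reference package on a radius `R₁ > 0` is admissible.
[cite: Balaban1988RG2Cluster, p.15, (2.16) p.16] -/
theorem admissible_toWalkPackage {r : RefPackage} (hr : r.Admissible) {R₁ : ℝ} (hR₁ : 0 < R₁) :
    (r.toWalkPackage R₁).Admissible where
  hR := hR₁
  hεL := hr.hεL
  hkapL := hr.hkapL
  hKbarL := hr.hKbarL
  hεP := hr.hεP
  hkapP := hr.hkapP
  hKbarP := hr.hKbarP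
  hm := by show 0 < r.m₀ / 2; linarith [hr.hm₀]
  hεA := hr.hεA
  hkapA := hr.hkapA.le
  hKbarA := hr.hKbarA
  hmA := by show 0 < r.mA₀ / 2; linarith [hr.hmA₀]
  hη := hr.hη.le
  hcV := cV_nonneg hr
  hcV₀ := cV₀_nonneg hr

end RefPackage

section Rung

variable {c : B13.Consts}

/-- **THE REFERENCE DATUM OF ONE (2.14)-TERM** (Prop): `X ≠ ∅`; the product reading `G2 = L·P^{−1/2}` with joint walk expansions of `L`
and of `P` through `X` on the `R`-ball and `m₀`-accretivity of `P` AT THE REFERENCE CONFIGURATION `(0,0)` ONLY; a joint walk expansion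
of `A2` and `m_{A,0}`-accretivity of `A2(0,0)`; far-ness `≥ R_σ` of the row locations `locΛ` AND of the column locations `locN` from `X`
(print p. 13: the kernels' arguments lie in `Z₀`, the parameters on the cubes of `σ₀` outside `Z′₀`); multiplicity `≤ n_B` of both
location maps; torus dimension `≤ d_m`.  Compared with `TermWalks`: NO accretivity at complex `(σ,u)` and NO volume sum is asked.
[cite: Balaban1988RG2Cluster, (2.7) p.13, p.15, (2.14)–(2.16) pp.15–16; Balaban1985BackgroundPropagators, Thm 3.10 p.416, Thm 3.12 p.423] -/
structure TermWalksRef (𝒦 : TermKernels c d N' ν Nf E) [Fintype 𝒦.C₀] [DecidableEq 𝒦.C₀] (r : RefPackage) : Prop where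
  nonempty : 𝒦.X.Nonempty
  product : ∃ (L : (TPt d N' → ℂ) → E → Matrix 𝒦.Λ (𝒦.Λ ⊕ 𝒦.C₀) ℂ)
      (P : (TPt d N' → ℂ) → E → Matrix (𝒦.Λ ⊕ 𝒦.C₀) (𝒦.Λ ⊕ 𝒦.C₀) ℂ),
      (∀ σ u, 𝒦.G2 σ u = L σ u * invSqrt (P σ u)) ∧
      (∃ (W : Type) (T : W → (TPt d N' → ℂ) → E → Matrix 𝒦.Λ (𝒦.Λ ⊕ 𝒦.C₀) ℂ) (SX : Set W) (A : W → ℝ)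
          (D : W → UT Nf → UT Nf → ℝ) (ρw : ℝ),
          JointWalkExpansion c 𝒦.locΛ 𝒦.locN L 𝒦.X r.R r.εL r.kapL r.KbarL T SX A D ρw) ∧
      (∃ (W : Type) (T : W → (TPt d N' → ℂ) → E → Matrix (𝒦.Λ ⊕ 𝒦.C₀) (𝒦.Λ ⊕ 𝒦.C₀) ℂ) (SX : Set W) (A : W → ℝ)
          (D : W → UT Nf → UT Nf → ℝ) (ρw : ℝ),
          JointWalkExpansion c 𝒦.locN 𝒦.locN P 𝒦.X r.R r.εP r.kapP r.KbarP T SX A D ρw) ∧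
      (∀ v : 𝒦.Λ ⊕ 𝒦.C₀ → ℂ, r.m₀ * ∑ i, ‖v i‖ ^ 2 ≤ (∑ i, star (v i) * (P 0 0 *ᵥ v) i).re)
  precision : ∃ (W : Type) (T : W → (TPt d N' → ℂ) → E → Matrix 𝒦.Λ 𝒦.Λ ℂ) (SX : Set W) (A : W → ℝ)
      (D : W → UT Nf → UT Nf → ℝ) (ρw : ℝ), JointWalkExpansion c 𝒦.locΛ 𝒦.locΛ 𝒦.A2 𝒦.X r.R r.εA r.kapA r.KbarA T SX A D ρw
  refAccA : ∀ v : 𝒦.Λ → ℂ, r.mA₀ * ∑ i, ‖v i‖ ^ 2 ≤ (∑ i, star (v i) * (𝒦.A2 0 0 *ᵥ v) i).re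
  far : ∀ b : 𝒦.Λ, ∀ z ∈ 𝒦.X, r.Rσ ≤ tdist1 Nf (𝒦.locΛ b) z
  farN : ∀ k : 𝒦.Λ ⊕ 𝒦.C₀, ∀ z ∈ 𝒦.X, r.Rσ ≤ tdist1 Nf (𝒦.locN k) z
  multΛ : ∀ x : UT Nf, (Finset.univ.filter fun b : 𝒦.Λ => 𝒦.locΛ b = x).card ≤ r.nB
  multN : ∀ x : UT Nf, (Finset.univ.filter fun k : 𝒦.Λ ⊕ 𝒦.C₀ => 𝒦.locN k = x).card ≤ r.nB
  dim : ν ≤ r.dm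

/-- **THE RUNG FROM REFERENCE DATA**: an admissible reference package `r`, a reference datum of the term, an accretivity radius
`0 < R₁ < R` and the two MARGINS
`(2K̄_Pe^{−ε_PR_σ} + 2K̄_PR₁/R)·c_V₀ ≤ m₀/2` and `(2K̄_Ae^{−ε_AR_σ} + 2K̄_AR₁/R)·c_V ≤ m_{A,0}/2`
(print's `O(1)e^{−⅓δ₀M} + O(α₀ + α₁)` against the reference positivity) give the W-walks datum `TermWalks 𝒦 (r.toWalkPackage R₁)`:
the three expansions restricted to the `R₁`-ball (`JointWalkExpansion.mono`), the two accretivities at every `(σ,u)` of polydisc ×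
`R₁`-ball with HALF the reference constants (§3), the five volume sums from the multiplicities (§1), far-ness verbatim.
[cite: Balaban1988RG2Cluster, (2.7) p.13, p.15, (2.14)–(2.16) pp.15–16; Balaban1985BackgroundPropagators, Thm 3.10 p.416, Thm 3.12 p.423, (3.154) p.427] -/
theorem termWalks_of_ref {𝒦 : TermKernels c d N' ν Nf E} [Fintype 𝒦.C₀] [DecidableEq 𝒦.C₀] {r : RefPackage}
    (hr : r.Admissible) (h : TermWalksRef 𝒦 r) {R₁ : ℝ} (hR₁ : 0 < R₁) (hR₁R : R₁ < r.R)
    (hP : (2 * r.KbarP * Real.exp (-(r.εP * r.Rσ)) + 2 * r.KbarP * R₁ / r.R) * r.cV₀ ≤ r.m₀ / 2)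
    (hA : (2 * r.KbarA * Real.exp (-(r.εA * r.Rσ)) + 2 * r.KbarA * R₁ / r.R) * r.cV ≤ r.mA₀ / 2) :
    TermWalks 𝒦 (r.toWalkPackage R₁) := by
  obtain ⟨L, P, hG2, ⟨WL, TL, SXL, AL, DL, ρwL, hJL⟩, ⟨WP, TP, SXP, AP, DP, ρwP, hJP⟩, hPacc⟩ := h.product
  obtain ⟨WA, TA, SXA, AA, DA, ρwA, hJA⟩ := h.precision
  have hcV : 0 ≤ r.cV := RefPackage.cV_nonneg hr
  have hcV₀ : 0 ≤ r.cV₀ := RefPackage.cV₀_nonneg hr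
  have hkP2 : 0 < r.kapP / 2 := by linarith [hr.hkapP]
  -- the five volume sums from the multiplicities (§1)
  have hvolN₀ : ∀ i : 𝒦.Λ ⊕ 𝒦.C₀,
      ∑ k : 𝒦.Λ ⊕ 𝒦.C₀, Real.exp (-(r.kapP / 2 * tdist1 Nf (𝒦.locN i) (𝒦.locN k))) ≤ r.cV₀ :=
    fun i => volume_of_multiplicity 𝒦.locN h.multN hkP2 h.dim (𝒦.locN i)
  have hvolN : ∀ i : 𝒦.Λ ⊕ 𝒦.C₀,
      ∑ k : 𝒦.Λ ⊕ 𝒦.C₀, Real.exp (-(r.η * tdist1 Nf (𝒦.locN i) (𝒦.locN k))) ≤ r.cV :=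
    fun i => volume_of_multiplicity 𝒦.locN h.multN hr.hη h.dim (𝒦.locN i)
  have hvolN' : ∀ j : 𝒦.Λ ⊕ 𝒦.C₀,
      ∑ l : 𝒦.Λ ⊕ 𝒦.C₀, Real.exp (-(r.η * tdist1 Nf (𝒦.locN l) (𝒦.locN j))) ≤ r.cV := fun j =>
    calc ∑ l : 𝒦.Λ ⊕ 𝒦.C₀, Real.exp (-(r.η * tdist1 Nf (𝒦.locN l) (𝒦.locN j)))
        = ∑ l : 𝒦.Λ ⊕ 𝒦.C₀, Real.exp (-(r.η * tdist1 Nf (𝒦.locN j) (𝒦.locN l))) :=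
          Finset.sum_congr rfl fun l _ => by rw [tdist1_comm]
      _ ≤ r.cV := hvolN j
  have hvolΛN : ∀ i : 𝒦.Λ,
      ∑ k : 𝒦.Λ ⊕ 𝒦.C₀, Real.exp (-(r.η * tdist1 Nf (𝒦.locΛ i) (𝒦.locN k))) ≤ r.cV :=
    fun i => volume_of_multiplicity 𝒦.locN h.multN hr.hη h.dim (𝒦.locΛ i)
  have hvolΛ : ∀ i : 𝒦.Λ, ∑ k : 𝒦.Λ, Real.exp (-(r.η * tdist1 Nf (𝒦.locΛ i) (𝒦.locΛ k))) ≤ r.cV :=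
    fun i => volume_of_multiplicity 𝒦.locΛ h.multΛ hr.hη h.dim (𝒦.locΛ i)
  -- the two accretivities at complex (σ,u) from the reference configuration (§3)
  have haccP : ∀ σ : TPt d N' → ℂ, (∀ j, ‖σ j‖ ≤ Real.exp c.κ₁) → ∀ u ∈ ball (0 : E) R₁,
      ∀ v : 𝒦.Λ ⊕ 𝒦.C₀ → ℂ, r.m₀ / 2 * ∑ i, ‖v i‖ ^ 2 ≤ (∑ i, star (v i) * (P σ u *ᵥ v) i).re := by
    intro σ hσ u hu v
    have hu' : ‖u‖ ≤ R₁ := by rw [mem_ball, dist_zero_right] at hu; exact hu.le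
    have hacc := accretive_of_jointWalkExpansion_far hJP hr.hR hr.hεP hr.hKbarP (κ := r.kapP / 2)
      (by linarith [hr.hkapP]) h.farN hPacc hcV₀ hvolN₀ hR₁.le hR₁R σ hσ hu' v
    have hS : 0 ≤ ∑ i, ‖v i‖ ^ 2 := Finset.sum_nonneg fun i _ => by positivity
    exact le_trans (mul_le_mul_of_nonneg_right (by linarith [hP]) hS) hacc
  have haccA : ∀ σ : TPt d N' → ℂ, (∀ j, ‖σ j‖ ≤ Real.exp c.κ₁) → ∀ u ∈ ball (0 : E) R₁,
      ∀ v : 𝒦.Λ → ℂ, r.mA₀ / 2 * ∑ i, ‖v i‖ ^ 2 ≤ (∑ i, star (v i) * (𝒦.A2 σ u *ᵥ v) i).re := by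
    intro σ hσ u hu v
    have hu' : ‖u‖ ≤ R₁ := by rw [mem_ball, dist_zero_right] at hu; exact hu.le
    have hacc := accretive_of_jointWalkExpansion_far hJA hr.hR hr.hεA hr.hKbarA (κ := r.η) hr.hηA h.far h.refAccA
      hcV hvolΛ hR₁.le hR₁R σ hσ hu' v
    have hS : 0 ≤ ∑ i, ‖v i‖ ^ 2 := Finset.sum_nonneg fun i _ => by positivity
    exact le_trans (mul_le_mul_of_nonneg_right (by linarith [hA]) hS) hacc
  exact
    { nonempty := h.nonempty
      product := ⟨L, P, hG2, ⟨WL, TL, SXL, AL, DL, ρwL, hJL.mono hR₁R.le le_rfl le_rfl hr.hKbarL le_rfl⟩,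
        ⟨WP, TP, SXP, AP, DP, ρwP, hJP.mono hR₁R.le le_rfl le_rfl hr.hKbarP le_rfl⟩, haccP⟩
      precision := ⟨WA, TA, SXA, AA, DA, ρwA, hJA.mono hR₁R.le le_rfl le_rfl hr.hKbarA le_rfl⟩
      accA := haccA
      volN₀ := hvolN₀
      volN := hvolN
      volN' := hvolN'
      volΛN := hvolΛN
      volΛ := hvolΛ
      far := h.far }

/-! ## §5. Across the family: `UniformWalksAcrossRef ⟹ UniformWalksAcross ⟹ ExistsUniformAcrossSmall`, by name -/

/-- **THE REFERENCE RUNG — UNIFORM ACROSS THE FAMILY**: ONE reference package `r` such that every term of every member `𝓣 s` carries a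
reference datum with it (extra columns finite: `∃`-binders).  The candidate uniform statement in REFERENCE currency: print's
[13]-expansions at complex backgrounds + positivity at `(U′,0)` + geometry, with k-, history- and torus-UNIFORM constants.  STATEMENT ONLY.
[cite: Balaban1988RG2Cluster, p.13, p.15; Balaban1985BackgroundPropagators, Thm 3.10 p.416, Thm 3.12 p.423] -/
def UniformWalksAcrossRef {S : Type*} (𝓣 : S → TorusTerms c d) (r : RefPackage) : Prop :=
  ∀ s, ∀ i : (𝓣 s).ι, ∃ (_ : Fintype ((𝓣 s).𝒦 i).C₀) (_ : DecidableEq ((𝓣 s).𝒦 i).C₀), TermWalksRef ((𝓣 s).𝒦 i) r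

/-- **`UniformWalksAcross` FROM THE REFERENCE RUNG** (termwise §4, one radius and the two margins for the whole family).
[cite: Balaban1988RG2Cluster, p.13, p.15, (2.16) p.16; Balaban1985BackgroundPropagators, Thm 3.10 p.416, Thm 3.12 p.423] -/
theorem uniformWalksAcross_of_ref {S : Type*} {𝓣 : S → TorusTerms c d} {r : RefPackage} (hr : r.Admissible)
    (hall : UniformWalksAcrossRef 𝓣 r) {R₁ : ℝ} (hR₁ : 0 < R₁) (hR₁R : R₁ < r.R)
    (hP : (2 * r.KbarP * Real.exp (-(r.εP * r.Rσ)) + 2 * r.KbarP * R₁ / r.R) * r.cV₀ ≤ r.m₀ / 2)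
    (hA : (2 * r.KbarA * Real.exp (-(r.εA * r.Rσ)) + 2 * r.KbarA * R₁ / r.R) * r.cV ≤ r.mA₀ / 2) :
    UniformWalksAcross 𝓣 (r.toWalkPackage R₁) := fun s i => by
  obtain ⟨instF, instD, h⟩ := hall s i
  exact ⟨instF, instD, termWalks_of_ref hr h hR₁ hR₁R hP hA⟩

/-- **NODE O's BINDER (:353) FROM THE REFERENCE RUNG, THRESHOLD FORM** — `acrossSmall_of_walks_std` BY NAME on the package
`q = r.toWalkPackage R₁`: given the reference rung, the radius and the two margins, positive input rates and `η ≤ etaMax q`, then for every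
`θ₀ > 0` the two printed smallness sources as thresholds (`α ≤ θ₀R₁/(4K̄+4)`, `R_σ ≥ log((4K̄+4)/θ₀)/(μ/4 − κ_C⋆)`, `K̄ = q.Kbar`) give
`ExistsUniformAcrossSmall 𝓣 α R_σ0 θ₀`.  The hypothesis `UniformWalksAcrossRef 𝓣_Bałaban r` for BAŁABAN's family is NOT supplied.
[cite: Balaban1988RG2Cluster, (1.11) p.5, p.13, p.15, (2.16) p.16; Balaban1985BackgroundPropagators, Thm 3.10 p.416, Thm 3.12 p.423] -/
theorem acrossSmall_of_ref_std {S : Type*} {𝓣 : S → TorusTerms c d} {r : RefPackage} (hr : r.Admissible)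
    (hall : UniformWalksAcrossRef 𝓣 r) {R₁ : ℝ} (hR₁ : 0 < R₁) (hR₁R : R₁ < r.R)
    (hP : (2 * r.KbarP * Real.exp (-(r.εP * r.Rσ)) + 2 * r.KbarP * R₁ / r.R) * r.cV₀ ≤ r.m₀ / 2)
    (hA : (2 * r.KbarA * Real.exp (-(r.εA * r.Rσ)) + 2 * r.KbarA * R₁ / r.R) * r.cV ≤ r.mA₀ / 2)
    (hp : (r.toWalkPackage R₁).PositiveRates) (hη : (r.toWalkPackage R₁).η ≤ (r.toWalkPackage R₁).etaMax)
    {α Rσ₀ θ₀ : ℝ} (hθ₀ : 0 < θ₀) (hα : 0 ≤ α) (hαR : α < R₁) (hRσ : Rσ₀ ≤ r.Rσ)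
    (hαsmall : α ≤ θ₀ * R₁ / (4 * (r.toWalkPackage R₁).Kbar + 4))
    (hRσlarge : Real.log ((4 * (r.toWalkPackage R₁).Kbar + 4) / θ₀)
      / ((r.toWalkPackage R₁).mu / 4 - (r.toWalkPackage R₁).kapCStar) ≤ r.Rσ) :
    ExistsUniformAcrossSmall 𝓣 α Rσ₀ θ₀ :=
  acrossSmall_of_walks_std (uniformWalksAcross_of_ref hr hall hR₁ hR₁R hP hA) (RefPackage.admissible_toWalkPackage hr hR₁)
    hp hη hθ₀ hα hαR hRσ hαsmall hRσlarge

/-! ## §6. The two margins as thresholds: far-ness LARGE, accretivity radius SMALL (order of choices, no circularity) -/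

/-- **A margin from two division-free thresholds**: `8Kc·e^{−εR_σ} ≤ m` (σ-cubes far: print's `O(1)e^{−⅓δ₀M}` against the gap) and
`8Kc·R₁ ≤ mR` (the accretivity radius a fixed fraction of the analyticity radius: print's `O(α₀ + α₁)`) give
`(2Ke^{−εR_σ} + 2KR₁/R)·c ≤ m/2`.  Pure arithmetic. [cite: Balaban1988RG2Cluster, p.15, (2.16) p.16] -/
theorem margin_of_thresholds {K c ε Rσ R₁ R m : ℝ} (hR : 0 < R)
    (hσ : 8 * K * c * Real.exp (-(ε * Rσ)) ≤ m) (h₁ : 8 * K * c * R₁ ≤ m * R) :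
    (2 * K * Real.exp (-(ε * Rσ)) + 2 * K * R₁ / R) * c ≤ m / 2 := by
  have h₂ : 2 * K * R₁ / R * c ≤ m / 4 := by
    rw [div_mul_eq_mul_div, div_le_iff₀ hR]
    linarith
  have h₃ : 2 * K * Real.exp (-(ε * Rσ)) * c ≤ m / 4 := by linarith
  calc (2 * K * Real.exp (-(ε * Rσ)) + 2 * K * R₁ / R) * c
      = 2 * K * Real.exp (-(ε * Rσ)) * c + 2 * K * R₁ / R * c := by ring
    _ ≤ m / 4 + m / 4 := add_le_add h₃ h₂
    _ = m / 2 := by ring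

/-- **THE RUNG FROM REFERENCE DATA, THRESHOLD FORM**: the two margins of `termWalks_of_ref` replaced by four division-free thresholds —
`8K̄_Pc_V₀e^{−ε_PR_σ} ≤ m₀`, `8K̄_Pc_V₀R₁ ≤ m₀R`, `8K̄_Ac_Ve^{−ε_AR_σ} ≤ m_{A,0}`, `8K̄_Ac_VR₁ ≤ m_{A,0}R`.  ORDER OF CHOICES: the
reference package fixes `(K̄, m₀, c_V, ε)`; THEN `R_σ` is taken large and `R₁` small — neither threshold reads the other.
[cite: Balaban1988RG2Cluster, p.13, p.15, (2.16) p.16; Balaban1985BackgroundPropagators, Thm 3.10 p.416, Thm 3.12 p.423] -/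
theorem termWalks_of_ref_thresholds {𝒦 : TermKernels c d N' ν Nf E} [Fintype 𝒦.C₀] [DecidableEq 𝒦.C₀] {r : RefPackage}
    (hr : r.Admissible) (h : TermWalksRef 𝒦 r) {R₁ : ℝ} (hR₁ : 0 < R₁) (hR₁R : R₁ < r.R)
    (hPσ : 8 * r.KbarP * r.cV₀ * Real.exp (-(r.εP * r.Rσ)) ≤ r.m₀) (hP₁ : 8 * r.KbarP * r.cV₀ * R₁ ≤ r.m₀ * r.R)
    (hAσ : 8 * r.KbarA * r.cV * Real.exp (-(r.εA * r.Rσ)) ≤ r.mA₀) (hA₁ : 8 * r.KbarA * r.cV * R₁ ≤ r.mA₀ * r.R) :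
    TermWalks 𝒦 (r.toWalkPackage R₁) :=
  termWalks_of_ref hr h hR₁ hR₁R (margin_of_thresholds hr.hR hPσ hP₁) (margin_of_thresholds hr.hR hAσ hA₁)

/-- **NODE O's BINDER (:353) FROM THE REFERENCE RUNG WITH EVERY SMALLNESS SOURCE A THRESHOLD**: the four margin thresholds of
`termWalks_of_ref_thresholds` (reference positivity against `e^{−ε R_σ}` and `R₁/R`), positive input rates, `η ≤ etaMax`, and the two
exchange thresholds of `acrossSmall_of_walks_std` (`α ≤ θ₀R₁/(4K̄+4)`, `R_σ ≥ log((4K̄+4)/θ₀)/(μ/4 − κ_C⋆)`) give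
`ExistsUniformAcrossSmall 𝓣 α R_σ0 θ₀` for every `θ₀ > 0`.  What is NOT supplied: `UniformWalksAcrossRef 𝓣_Bałaban r`.
[cite: Balaban1988RG2Cluster, (1.11) p.5, p.13, p.15, (2.16) p.16; Balaban1985BackgroundPropagators, Thm 3.10 p.416, Thm 3.12 p.423] -/
theorem acrossSmall_of_ref_thresholds {S : Type*} {𝓣 : S → TorusTerms c d} {r : RefPackage} (hr : r.Admissible)
    (hall : UniformWalksAcrossRef 𝓣 r) {R₁ : ℝ} (hR₁ : 0 < R₁) (hR₁R : R₁ < r.R)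
    (hPσ : 8 * r.KbarP * r.cV₀ * Real.exp (-(r.εP * r.Rσ)) ≤ r.m₀) (hP₁ : 8 * r.KbarP * r.cV₀ * R₁ ≤ r.m₀ * r.R)
    (hAσ : 8 * r.KbarA * r.cV * Real.exp (-(r.εA * r.Rσ)) ≤ r.mA₀) (hA₁ : 8 * r.KbarA * r.cV * R₁ ≤ r.mA₀ * r.R)
    (hp : (r.toWalkPackage R₁).PositiveRates) (hη : (r.toWalkPackage R₁).η ≤ (r.toWalkPackage R₁).etaMax)
    {α Rσ₀ θ₀ : ℝ} (hθ₀ : 0 < θ₀) (hα : 0 ≤ α) (hαR : α < R₁) (hRσ : Rσ₀ ≤ r.Rσ)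
    (hαsmall : α ≤ θ₀ * R₁ / (4 * (r.toWalkPackage R₁).Kbar + 4))
    (hRσlarge : Real.log ((4 * (r.toWalkPackage R₁).Kbar + 4) / θ₀)
      / ((r.toWalkPackage R₁).mu / 4 - (r.toWalkPackage R₁).kapCStar) ≤ r.Rσ) :
    ExistsUniformAcrossSmall 𝓣 α Rσ₀ θ₀ :=
  acrossSmall_of_ref_std hr hall hR₁ hR₁R (margin_of_thresholds hr.hR hPσ hP₁) (margin_of_thresholds hr.hR hAσ hA₁)
    hp hη hθ₀ hα hαR hRσ hαsmall hRσlarge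

end Rung

end Literature.MathematicalPhysics.QuantumFieldTheory.Balaban1983to89.NodeOLettersOfWalksPerturbative

end
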